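import Mathlib.RingTheory.Polynomial.UniqueFactorization
import Mathlib.Algebra.MvPolynomial.PDeriv
import Mathlib.Tactic.LinearCombination
import Literature.RingTheory.MvPolynomial.RuppertGaoResidues
import Literature.RingTheory.MvPolynomial.RuppertReducibleProofs
import HarnessLib

/-!
# The Gao–Ruppert kernel theorem: the kernel of Ruppert's map is spanned by the factor pairs

Topic `Literature/RingTheory/MvPolynomial`; continues `RuppertMatrix.lean` (Ruppert's operator
`R_φ(G, H) = φ G_Y − G φ_Y − φ H_X + H φ_X`, the numerator of `∂_Y(G/φ) − ∂_X(H/φ)`, on the box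
`deg G, deg H ≤ d − 1`) and `RuppertReducibleProofs.lean` (Ruppert's Lemma 1: two kernel pairs for
a non-irreducible `φ`). Sources: S. Gao, *Factoring multivariate polynomials via partial
differential equations*, Math. Comp. 72 (2003) 801–822, **Thm. 2.3** ("Suppose
`gcd(f, f_x) = 1` … Then `dim_F G = r`, the number of absolutely irreducible factors of `f`; in
fact `{E_i = (f/f_i) ∂f_i/∂x}` is a basis of `G` over `F̄`") and W. M. Ruppert, *Reducibility of
polynomials `f(x, y)` modulo `p`*, J. Number Theory 77 (1999) 62–70, §3. We prove the theorem in
the tree's TOTAL-DEGREE normalisation (both unknowns of degree `≤ deg φ − 1`), for which the same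
statement holds:

* `Ruppert.rupOp_factorPair`, `Ruppert.totalDegree_factorPair_le` — for every factorisation
  `φ = w t` the pair `E_w = (t ∂_X w, t ∂_Y w)` (the closed form `dw/w`) is a kernel pair in the box
  (Ruppert's Case I pair, tree `rupOp_logPair`);
* `Ruppert.factorPairs_independent` — over ANY field, the pairs `E_{w_j}` attached to pairwise
  non-associated irreducible factors `w_j` of `φ ≠ 0` with non-zero gradients are linearly
  independent (Gao's "linear independence" half, valid with multiplicities);
* `Ruppert.kernel_subset_span_factorPairs` — over an ALGEBRAICALLY CLOSED field of
  CHARACTERISTIC ZERO, for `φ = c · w₁ ⋯ w_r` squarefree of degree `d ≥ 1`, every kernel pair in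
  the box is an `F`-combination of the `E_{w_j}` (Gao's spanning half). Proof: for each factor
  `g = w_j`, `φ = g ψ`, a kernel pair satisfies `g ∣ G g_Y − H g_X` and the polynomial identity
  `key_identity` exhibits `G/(ψ g_X)` as a constant for the tangent derivation along `g = 0`; by
  the residue lemma `exists_C_dvd_sub_of_tangent` (`RuppertGaoResidues.lean`) `G ≡ c_j ψ g_X`,
  `H ≡ c_j ψ g_Y (mod g)`; then `G − Σ c_j E_j` is divisible by every `w_j`, hence by `φ`, and has
  degree `< deg φ`.

Consequently `dim ker R_φ = r` (the number of irreducible factors) in characteristic zero, and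
`dim ker R_φ ≥ r` in every characteristic in which the factors have non-zero gradients; the rank /
minor form is in `RuppertGaoRank.lean`. No definitions, no named facts; helpers private.

## References

* S. Gao, Math. Comp. 72 (2003) 801–822, Thm. 2.3. [`GaoPDE2003`]
* W. M. Ruppert, J. Number Theory 77 (1999) 62–70, §2–3. [`Ruppert1999`]
-/

noncomputable section

open MvPolynomial

namespace Literature.RingTheory.MvPolynomial

namespace Ruppert

variable {F : Type*} [Field F]

/-! ### The factor pairs are kernel pairs in the box -/

/-- **The pair of a factorisation is a kernel pair**: for `φ = w t`, `R_φ(t w_X, t w_Y) = 0`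
(the closed logarithmic form `dw/w`; Gao's `E_i`, Ruppert's Case I pair).
[cite: GaoPDE2003, Thm. 2.3 (proof, "E_i ∈ G")] -/
theorem rupOp_factorPair {φ w t : MvPolynomial (Fin 2) F} (hφ : φ = w * t) :
    rupOp φ (t * pderiv 0 w) (t * pderiv 1 w) = 0 := by
  rw [hφ]; exact rupOp_logPair w t

/-- An irreducible polynomial is non-constant. [folklore] -/
private theorem totalDegree_pos_of_irreducible' {g : MvPolynomial (Fin 2) F} (hg : Irreducible g) :
    0 < g.totalDegree := by
  by_contra h0
  have h0' : g.totalDegree = 0 := by omega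
  by_cases hc : coeff 0 g = 0
  · apply hg.ne_zero
    rw [totalDegree_eq_zero_iff_eq_C] at h0'
    rw [h0', hc, C_0]
  · exact hg.not_isUnit (MvPolynomial.isUnit_iff_totalDegree_of_isReduced.mpr
      ⟨(Ne.isUnit hc), h0'⟩)

/-- **The factor pairs lie in the box**: for `φ = w t ≠ 0`, `deg (t ∂ᵢ w) ≤ deg φ − 1`.
[cite: GaoPDE2003, Thm. 2.3 (proof, degrees of E_i)] -/
theorem totalDegree_factorPair_le {φ w t : MvPolynomial (Fin 2) F} (hφ : φ = w * t) (hφ0 : φ ≠ 0)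
    (i : Fin 2) : (t * pderiv i w).totalDegree ≤ φ.totalDegree - 1 := by
  have hw0 : w ≠ 0 := fun h => hφ0 (by rw [hφ, h, zero_mul])
  have ht0 : t ≠ 0 := fun h => hφ0 (by rw [hφ, h, mul_zero])
  by_cases hd : pderiv i w = 0
  · rw [hd, mul_zero, totalDegree_zero]; exact Nat.zero_le _
  rw [totalDegree_mul_of_isDomain ht0 hd, hφ, totalDegree_mul_of_isDomain hw0 ht0]
  have h1 := totalDegree_pderiv_le i w
  have h2 : 0 < w.totalDegree := by
    by_contra h0
    have : w.totalDegree = 0 := by omega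
    rw [totalDegree_eq_zero_iff_eq_C] at this
    exact hd (by rw [this, pderiv_C])
  omega

/-! ### Linear independence of the factor pairs (any characteristic) -/

/-- **The factor pairs are linearly independent** (Gao, Thm. 2.3, independence half — here with
multiplicities allowed): let `φ ≠ 0` and `w₀, …, w_{r−1}` pairwise non-associated irreducible
factors, `φ = w_j t_j`, each `w_j` with a non-zero gradient. If `Σ a_j (t_j ∂_X w_j) = 0` and
`Σ a_j (t_j ∂_Y w_j) = 0` then all `a_j = 0`. (If `w_j^e ∥ φ`, every other term is divisible by
`w_j^e` while `t_j ∂ w_j` is divisible by `w_j^{e−1}` only, unless `w_j ∣ ∂ w_j`, i.e. `∂ w_j = 0`.)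
[cite: GaoPDE2003, Thm. 2.3 (proof, linear independence of the E_i)] -/
theorem factorPairs_independent {r : ℕ} {φ : MvPolynomial (Fin 2) F} (hφ0 : φ ≠ 0)
    (w t : Fin r → MvPolynomial (Fin 2) F) (hw : ∀ j, Irreducible (w j))
    (hwt : ∀ j, φ = w j * t j) (hna : ∀ j k, j ≠ k → ¬ w j ∣ w k)
    (hgrad : ∀ j, pderiv 0 (w j) ≠ 0 ∨ pderiv 1 (w j) ≠ 0)
    (a : Fin r → F) (hG : ∑ j, a j • (t j * pderiv 0 (w j)) = 0)
    (hH : ∑ j, a j • (t j * pderiv 1 (w j)) = 0) : ∀ j, a j = 0 := by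
  classical
  intro j
  by_contra haj
  have hprime : Prime (w j) := (hw j).prime
  have hwpos : 0 < (w j).totalDegree := totalDegree_pos_of_irreducible' (hw j)
  obtain ⟨e, he1, s, hes, hws⟩ := exists_max_pow_dvd hwpos hφ0 ⟨t j, hwt j⟩
  -- `t_j = w_j^{e-1} s`
  have htj : t j = w j ^ (e - 1) * s := by
    have h := hwt j
    rw [hes, show e = (e - 1) + 1 from (Nat.sub_add_cancel he1).symm, pow_succ] at h
    have h' : w j * t j = w j * (w j ^ (e - 1) * s) := by rw [← h]; ring
    exact mul_left_cancel₀ hprime.ne_zero h'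
  -- the other cofactors are divisible by `w_j^e`
  have htk : ∀ k, k ≠ j → w j ^ e ∣ t k := by
    intro k hk
    refine hprime.pow_dvd_of_dvd_mul_left e (hna j k hk.symm) ?_
    rw [← hwt k, hes]; exact dvd_mul_right _ _
  -- each derivative of `w_j` vanishes
  have key : ∀ i : Fin 2, ∑ k, a k • (t k * pderiv i (w k)) = 0 → pderiv i (w j) = 0 := by
    intro i hsum
    rw [← Finset.add_sum_erase _ _ (Finset.mem_univ j)] at hsum
    have hrest : w j ^ e ∣ ∑ k ∈ Finset.univ.erase j, a k • (t k * pderiv i (w k)) :=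
      Finset.dvd_sum fun k hk => by
        rw [smul_eq_C_mul, ← mul_assoc, mul_comm (C (a k)), mul_assoc]
        exact dvd_mul_of_dvd_left (htk k (Finset.ne_of_mem_erase hk)) _
    have hjt : w j ^ e ∣ a j • (t j * pderiv i (w j)) := by
      have := dvd_neg.mpr hrest
      rwa [← eq_neg_of_add_eq_zero_left hsum] at this
    have hpow : w j ^ e = w j ^ (e - 1) * w j := by
      rw [← pow_succ, Nat.sub_add_cancel he1]
    rw [htj, smul_eq_C_mul, hpow,
      show C (a j) * (w j ^ (e - 1) * s * pderiv i (w j)) =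
        w j ^ (e - 1) * (C (a j) * s * pderiv i (w j)) by ring] at hjt
    have h1 : w j ∣ C (a j) * s * pderiv i (w j) :=
      (mul_dvd_mul_iff_left (pow_ne_zero _ hprime.ne_zero)).mp hjt
    rcases hprime.dvd_or_dvd h1 with h2 | h2
    · rcases hprime.dvd_or_dvd h2 with h3 | h3
      · exact absurd (isUnit_of_dvd_unit h3 ((Ne.isUnit haj).map C)) hprime.not_unit
      · exact absurd h3 hws
    · exact pderiv_eq_zero_of_dvd hwpos i h2
  rcases hgrad j with h | h
  · exact h (key 0 hG)
  · exact h (key 1 hH)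

/-! ### Spanning in characteristic zero -/

/-- The key polynomial identity behind the residue computation: for a kernel pair `(G, H)` of
`R_{gψ}` and `g M = G g_Y − H g_X`, with `δ = g_Y ∂_X − g_X ∂_Y` and `v = ψ g_X`,
`g · (δ(G) v − G δ(v)) = g · g · (v M_X − M v_X)`. [folklore] -/
private theorem key_identity (g ψ G H M : MvPolynomial (Fin 2) F)
    (hK : rupOp (g * ψ) G H = 0) (hM : g * M = G * pderiv 1 g - H * pderiv 0 g) :
    g * ((pderiv 1 g * pderiv 0 G - pderiv 0 g * pderiv 1 G) * (ψ * pderiv 0 g) -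
        G * (pderiv 1 g * pderiv 0 (ψ * pderiv 0 g) - pderiv 0 g * pderiv 1 (ψ * pderiv 0 g))) =
      g * (g * ((ψ * pderiv 0 g) * pderiv 0 M - M * pderiv 0 (ψ * pderiv 0 g))) := by
  have hMX := congrArg (pderiv 0) hM
  simp only [rupOp, Derivation.leibniz, smul_eq_mul, map_sub, pderiv_zero_pderiv_one] at hK hMX ⊢
  linear_combination (-(pderiv 0 g) ^ 2) * hK + (-(ψ * pderiv 0 g * g)) * hMX +
    (g * (ψ * pderiv 0 (pderiv 0 g) + pderiv 0 g * pderiv 0 ψ) + (pderiv 0 g) ^ 2 * ψ) * hM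

/-- The mirror identity with `v = ψ g_Y` and the unknown `H`. [folklore] -/
private theorem key_identity' (g ψ G H M : MvPolynomial (Fin 2) F)
    (hK : rupOp (g * ψ) G H = 0) (hM : g * M = G * pderiv 1 g - H * pderiv 0 g) :
    g * ((pderiv 1 g * pderiv 0 H - pderiv 0 g * pderiv 1 H) * (ψ * pderiv 1 g) -
        H * (pderiv 1 g * pderiv 0 (ψ * pderiv 1 g) - pderiv 0 g * pderiv 1 (ψ * pderiv 1 g))) =
      g * (g * ((ψ * pderiv 1 g) * pderiv 1 M - M * pderiv 1 (ψ * pderiv 1 g))) := by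
  have hMY := congrArg (pderiv 1) hM
  simp only [rupOp, Derivation.leibniz, smul_eq_mul, map_sub, pderiv_zero_pderiv_one] at hK hMY ⊢
  linear_combination (-(pderiv 1 g) ^ 2) * hK + (-(ψ * pderiv 1 g * g)) * hMY +
    (g * (ψ * pderiv 1 (pderiv 1 g) + pderiv 1 g * pderiv 1 ψ) + (pderiv 1 g) ^ 2 * ψ) * hM

/-- **The residue step**: for `φ = g ψ` with `g` irreducible, `g ∤ ψ` (`F` algebraically closed
of characteristic zero) and a kernel pair `(G, H)` of `R_φ`, there is a constant `c` with
`G ≡ c ψ g_X` and `H ≡ c ψ g_Y (mod g)`. [cite: GaoPDE2003, Thm. 2.3 (proof, residues λ_i)] -/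
theorem exists_residue [IsAlgClosed F] [CharZero F] {g ψ G H : MvPolynomial (Fin 2) F}
    (hg : Irreducible g) (hψ : ¬ g ∣ ψ) (hK : rupOp (g * ψ) G H = 0) :
    ∃ c : F, g ∣ G - C c * (ψ * pderiv 0 g) ∧ g ∣ H - C c * (ψ * pderiv 1 g) := by
  have hprime : Prime g := hg.prime
  -- `g ∣ G g_Y − H g_X`
  obtain ⟨M, hM⟩ : g ∣ G * pderiv 1 g - H * pderiv 0 g := by
    have h : ψ * (G * pderiv 1 g - H * pderiv 0 g) =
        g * (ψ * (pderiv 1 G - pderiv 0 H) - G * pderiv 1 ψ + H * pderiv 0 ψ) := by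
      simp only [rupOp, Derivation.leibniz, smul_eq_mul] at hK
      linear_combination -hK
    have h2 : g ∣ ψ * (G * pderiv 1 g - H * pderiv 0 g) := ⟨_, h⟩
    exact (hprime.dvd_or_dvd h2).resolve_left hψ
  rcases not_dvd_pderiv_or (totalDegree_pos_of_irreducible' hg) with hX | hY
  · -- `θ = G / (ψ g_X)`
    have hv : ¬ g ∣ ψ * pderiv 0 g := fun h => (hprime.dvd_or_dvd h).elim hψ hX
    have hkey : g ∣ (pderiv 1 g * pderiv 0 G - pderiv 0 g * pderiv 1 G) * (ψ * pderiv 0 g) -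
        G * (pderiv 1 g * pderiv 0 (ψ * pderiv 0 g) - pderiv 0 g * pderiv 1 (ψ * pderiv 0 g)) := by
      refine ⟨(ψ * pderiv 0 g) * pderiv 0 M - M * pderiv 0 (ψ * pderiv 0 g), ?_⟩
      exact mul_left_cancel₀ hprime.ne_zero (key_identity g ψ G H M hK hM.symm)
    obtain ⟨c, hc⟩ := exists_C_dvd_sub_of_tangent hg hv hkey
    refine ⟨c, hc, ?_⟩
    -- `H g_X ≡ G g_Y ≡ c ψ g_X g_Y`
    have h1 : g ∣ pderiv 0 g * (H - C c * (ψ * pderiv 1 g)) := by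
      have : pderiv 0 g * (H - C c * (ψ * pderiv 1 g)) =
          -(G * pderiv 1 g - H * pderiv 0 g) + pderiv 1 g * (G - C c * (ψ * pderiv 0 g)) := by ring
      rw [this]
      exact dvd_add (dvd_neg.mpr ⟨M, hM⟩) (dvd_mul_of_dvd_right hc _)
    exact (hprime.dvd_or_dvd h1).resolve_left hX
  · -- `θ = H / (ψ g_Y)`
    have hv : ¬ g ∣ ψ * pderiv 1 g := fun h => (hprime.dvd_or_dvd h).elim hψ hY
    have hkey : g ∣ (pderiv 1 g * pderiv 0 H - pderiv 0 g * pderiv 1 H) * (ψ * pderiv 1 g) -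
        H * (pderiv 1 g * pderiv 0 (ψ * pderiv 1 g) - pderiv 0 g * pderiv 1 (ψ * pderiv 1 g)) := by
      refine ⟨(ψ * pderiv 1 g) * pderiv 1 M - M * pderiv 1 (ψ * pderiv 1 g), ?_⟩
      exact mul_left_cancel₀ hprime.ne_zero (key_identity' g ψ G H M hK hM.symm)
    obtain ⟨c, hc⟩ := exists_C_dvd_sub_of_tangent hg hv hkey
    refine ⟨c, ?_, hc⟩
    have h1 : g ∣ pderiv 1 g * (G - C c * (ψ * pderiv 0 g)) := by
      have : pderiv 1 g * (G - C c * (ψ * pderiv 0 g)) =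
          (G * pderiv 1 g - H * pderiv 0 g) + pderiv 0 g * (H - C c * (ψ * pderiv 1 g)) := by ring
      rw [this]
      exact dvd_add ⟨M, hM⟩ (dvd_mul_of_dvd_right hc _)
    exact (hprime.dvd_or_dvd h1).resolve_left hY

/-- Pairwise non-associated primes each dividing `x` divide it jointly. [folklore] -/
private theorem prod_dvd_of_forall_dvd {r : ℕ} (w : Fin r → MvPolynomial (Fin 2) F)
    (hw : ∀ j, Prime (w j)) (hna : ∀ j k, j ≠ k → ¬ w j ∣ w k) {x : MvPolynomial (Fin 2) F}
    (hx : ∀ j, w j ∣ x) : ∏ j, w j ∣ x := by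
  classical
  suffices h : ∀ s : Finset (Fin r), ∏ j ∈ s, w j ∣ x from h Finset.univ
  intro s
  induction s using Finset.induction_on with
  | empty => simp
  | insert i s hi ih =>
    rw [Finset.prod_insert hi]
    obtain ⟨y, hy⟩ := ih
    have hiy : w i ∣ y := by
      have h := hx i
      rw [hy] at h
      rcases (hw i).dvd_or_dvd h with h | h
      · obtain ⟨k, hk, hik⟩ := (hw i).exists_mem_finset_dvd h
        exact absurd hik (hna i k (fun heq => hi (heq ▸ hk)))
      · exact h
    obtain ⟨z, rfl⟩ := hiy
    exact ⟨z, by rw [hy]; ring⟩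

/-- **Gao's theorem (spanning half), total-degree normalisation.** Let `F` be algebraically
closed of characteristic zero and `φ = c · w₀ ⋯ w_{r−1}` (`c ≠ 0`, `w_j` pairwise non-associated
irreducible — i.e. `φ` squarefree) of degree `d ≥ 1`. Then every pair `(G, H)` with
`deg G, deg H ≤ d − 1` and `R_φ(G, H) = 0` is `Σ_j a_j · (ψ_j ∂_X w_j, ψ_j ∂_Y w_j)`,
`ψ_j = c ∏_{k ≠ j} w_k`, for constants `a_j ∈ F` ("`{E_i}` spans `G ⊗ F̄`").
[cite: GaoPDE2003, Thm. 2.3] -/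
theorem kernel_subset_span_factorPairs [IsAlgClosed F] [CharZero F] {r d : ℕ}
    {φ : MvPolynomial (Fin 2) F} (hdeg : φ.totalDegree = d) (hd : 1 ≤ d) {c : F} (hc : c ≠ 0)
    (w : Fin r → MvPolynomial (Fin 2) F) (hw : ∀ j, Irreducible (w j))
    (hna : ∀ j k, j ≠ k → ¬ w j ∣ w k) (hφ : φ = C c * ∏ j, w j)
    {G H : MvPolynomial (Fin 2) F} (hG : G.totalDegree ≤ d - 1) (hH : H.totalDegree ≤ d - 1)
    (hR : rupOp φ G H = 0) :
    ∃ a : Fin r → F,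
      G = ∑ j, a j • ((C c * ∏ k ∈ Finset.univ.erase j, w k) * pderiv 0 (w j)) ∧
      H = ∑ j, a j • ((C c * ∏ k ∈ Finset.univ.erase j, w k) * pderiv 1 (w j)) := by
  classical
  have hφ0 : φ ≠ 0 := by
    intro h; rw [h, totalDegree_zero] at hdeg; omega
  -- cofactors
  set ψ : Fin r → MvPolynomial (Fin 2) F := fun j => C c * ∏ k ∈ Finset.univ.erase j, w k with hψ
  have hφj : ∀ j, φ = w j * ψ j := by
    intro j
    rw [hφ, hψ]
    simp only
    rw [mul_left_comm, Finset.mul_prod_erase _ _ (Finset.mem_univ j)]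
  have hψdvd : ∀ j k, k ≠ j → w k ∣ ψ j := fun j k hkj =>
    dvd_mul_of_dvd_right (Finset.dvd_prod_of_mem _ (Finset.mem_erase.mpr ⟨hkj, Finset.mem_univ k⟩)) _
  have hψndvd : ∀ j, ¬ w j ∣ ψ j := by
    intro j h
    rcases (hw j).prime.dvd_or_dvd h with h1 | h1
    · exact (hw j).prime.not_unit (isUnit_of_dvd_unit h1 ((Ne.isUnit hc).map C))
    · obtain ⟨k, hk, hjk⟩ := (hw j).prime.exists_mem_finset_dvd h1
      exact hna j k (Finset.ne_of_mem_erase hk).symm hjk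
  -- residues
  have hres : ∀ j, ∃ a : F, w j ∣ G - C a * (ψ j * pderiv 0 (w j)) ∧
      w j ∣ H - C a * (ψ j * pderiv 1 (w j)) := fun j =>
    exists_residue (hw j) (hψndvd j) (by rw [← hφj]; exact hR)
  choose a ha using hres
  refine ⟨a, ?_, ?_⟩
  · -- `G − Σ a_j E_j` is divisible by `φ` and has degree `< d`
    set G' := G - ∑ j, a j • (ψ j * pderiv 0 (w j)) with hG'
    have hdiv : ∀ k, w k ∣ G' := by
      intro k
      rw [hG', ← Finset.add_sum_erase _ _ (Finset.mem_univ k), smul_eq_C_mul, ← sub_sub]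
      refine dvd_sub (ha k).1 (Finset.dvd_sum fun j hj => ?_)
      rw [smul_eq_C_mul, ← mul_assoc, mul_comm (C (a j)), mul_assoc]
      exact dvd_mul_of_dvd_left (hψdvd j k (Finset.ne_of_mem_erase hj).symm) _
    have hφG' : φ ∣ G' := by
      rw [hφ]
      exact ((Ne.isUnit hc).map C).mul_left_dvd.mpr
        (prod_dvd_of_forall_dvd w (fun j => (hw j).prime) hna hdiv)
    have hG'deg : G'.totalDegree ≤ d - 1 := by
      rw [hG']
      refine (totalDegree_sub _ _).trans (max_le hG ?_)
      refine (totalDegree_finsetSum _ _).trans (Finset.sup_le fun j _ => ?_)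
      refine (totalDegree_smul_le _ _).trans ?_
      rw [← hdeg]
      exact totalDegree_factorPair_le (hφj j) hφ0 0
    have hG'0 : G' = 0 := by
      by_contra hne
      have := totalDegree_le_of_dvd_of_isDomain hφG' hne
      omega
    exact sub_eq_zero.mp hG'0
  · set H' := H - ∑ j, a j • (ψ j * pderiv 1 (w j)) with hH'
    have hdiv : ∀ k, w k ∣ H' := by
      intro k
      rw [hH', ← Finset.add_sum_erase _ _ (Finset.mem_univ k), smul_eq_C_mul, ← sub_sub]
      refine dvd_sub (ha k).2 (Finset.dvd_sum fun j hj => ?_)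
      rw [smul_eq_C_mul, ← mul_assoc, mul_comm (C (a j)), mul_assoc]
      exact dvd_mul_of_dvd_left (hψdvd j k (Finset.ne_of_mem_erase hj).symm) _
    have hφH' : φ ∣ H' := by
      rw [hφ]
      exact ((Ne.isUnit hc).map C).mul_left_dvd.mpr
        (prod_dvd_of_forall_dvd w (fun j => (hw j).prime) hna hdiv)
    have hH'deg : H'.totalDegree ≤ d - 1 := by
      rw [hH']
      refine (totalDegree_sub _ _).trans (max_le hH ?_)
      refine (totalDegree_finsetSum _ _).trans (Finset.sup_le fun j _ => ?_)
      refine (totalDegree_smul_le _ _).trans ?_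
      rw [← hdeg]
      exact totalDegree_factorPair_le (hφj j) hφ0 1
    have hH'0 : H' = 0 := by
      by_contra hne
      have := totalDegree_le_of_dvd_of_isDomain hφH' hne
      omega
    exact sub_eq_zero.mp hH'0

end Ruppert

end Literature.RingTheory.MvPolynomial

end
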